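import Mathlib
import HarnessLib
import HarnessLib.Audit
import Summits.CriticalPhenomena.Statement
import Literature.Probability.RandomPlanarGeometry.CurveTightness
import Literature.Probability.RandomPlanarGeometry.SAWWordBridges
import Literature.Probability.RandomPlanarGeometry.LaceExpansionPiN
import Summits.CriticalPhenomena.SAWScalingLimit.Theorems.SAWRenewalTightnessTightOfShellCrossing
import HarnessLib.Audit.Status.Attr

/-!
Route: SAWEdgeOfPositiveType

DORMANT since 2026-08-26T04:18:30Z (reconciler: no traction for 8.3 d (last activity item-evidence-added at 2026-08-17T19:24:59Z); parked, not closed — `ledger route dormant route-CriticalPhenomena-SAWEdgeOfPositiveType --off` to reacti) — unstaffed, not closed; items shared with open routes are served there. `ledger route dormant <id> --off` reactivates.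

# Route SAWEdgeOfPositiveType — the Schoenberg metric √(−log Z) of the polymer kernel on CONVEX
lattice domains turns averaged critical masses into pointwise ones, feeding Aizenman–Burchard
tightness

It suffices to show X = (CMT) ∧ (Avg) ∧ (AMD) ∧ (I) (rev 2, route choice after the substantive
refutation of the all-Λ umbrella).
Objects: for a finite Λ ⊂ ℤ² and fugacity x the POLYMER KERNEL Z^Λ_x(u,v) = Σ over self-avoiding
walks u → v with all sites in Λ of
x^(length) (unit diagonal; typed with Literature.Probability.RandomPlanarGeometry.SAW.Zd.sawFun),
x_c =
Literature.Probability.RandomPlanarGeometry.SAW.criticalFugacity, F = −log Z the polymer free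
energy; a CONVEX LATTICE DOMAIN is the trace
Λ = K ∩ ℤ² of a convex K ⊂ ℂ (typed: ∀ K, Convex ℝ K → ∀ Λ, (∀ z, z ∈ Λ ↔ Site.toComplex z ∈ K) → …)
— boxes, strips, and the tubes
T(u,v,ℓ) = {z : dist(z,[u,v]) ≤ ℓ/10+2} the engine works in (closed thickenings of segments,
Convex.cthickening).
 (CMT) ConvexMetricTriangle — for every convex lattice domain Λ and x ∈ [0, x_c], √F^Λ_x satisfies
the triangle inequality on Λ (pairs
with Z > 0): the three-point Schoenberg shadow of infinite divisibility, restricted to the domain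
class the engine consumes.
 (Avg) AveragedTubeMass — a MESOSCOPICALLY AVERAGED polynomial lower bound at x_c: the x_c-mass of
SAWs from u confined to T(u,v,ℓ)
(|u−v| ≤ ℓ) and ending within distance ℓ^α of v is ≥ c ℓ^(−C), some α < 1.
 (AMD) AnnularMassDecay and (I) SubseqIdentification — the annular RSW upper bound and the
identification of subsequential limits, shared
verbatim with route SAWRenewalTightness (stmt-CriticalPhenomena-4729, stmt-CriticalPhenomena-0783).
Mechanism (support ConvexMetricUpgrade : CMT → Avg → TubeLowerBound, stmt-CriticalPhenomena-13964,
provable now; it replaces the rev-0 MetricUpgrade whose antecedent was the all-Λ form): in the tube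
T (a convex lattice domain) pick v* ∈ B(v, ℓ^α)
carrying ≥ average mass, so F^T(u,v*) ≤ (C+2α) log ℓ + O(1); the sub-tube of [v*,v] sits inside T,
so F^T(v*,v) ≤ g(ℓ^α) by domain
monotonicity; (CMT) in T gives √F^T(u,v) ≤ √F^T(u,v*) + √F^T(v*,v), i.e. h(ℓ) ≤ √(C₁ log ℓ) +
h(ℓ^α), whence h(ℓ) ≤ √(C₁ log ℓ)/(1−√α) +
O(1) and Z^T(u,v) ≥ c′ ℓ^(−C₁/(1−√α)²): the POINTWISE TubeLowerBound of SAWRenewalTightness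
(stmt-CriticalPhenomena-4730) — a reverse
Simon–Lieb inequality up to polynomial factors. Then the shared surgery chain SurgeryReduction (AMD
→ TubeLowerBound → ShellCrossingBound),
TightOfShellCrossing (PROVED Aizenman–Burchard criterion
Literature.Probability.RandomPlanarGeometry.isTightMeasureSet_of_traversalBounds),
EventualTight and the self-contained germ criterion TightIdentificationCriterion with (I) close the
conjunct.
SCHOENBERG BRANCH (the restored mechanism, not load-bearing): crux ConvexInfiniteDivisibility (all
Hadamard powers of Z^Λ_x positive
definite for convex lattice domains, x ≤ x_c) implies (CMT) through the PROVED tree theorems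
Literature.Analysis.Matrix.Schoenberg1938_negDef_iff_exp_posDef_holds,
BCR1984_sqrt_negDef_semimetric_holds and
sqrt_neg_log_triangle_of_rpow_posDef (support SchoenbergToMetric, provable now): −log of an
infinitely divisible kernel is of negative
type and its square root is a Hilbertian semimetric, with Z ≤ 1 for free.
NEGATIVE EDGE AND ROUTE CHOICE (rev 2, 2026-08-15). The card's umbrella InfiniteDivisibility for
EVERY finite Λ (stmt-CriticalPhenomena-8261)
is REFUTED (Theorems/SAWEdgeOfPositiveTypeInfiniteDivisibilityRefutation.lean: Λ = theta(8,2), two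
lattice holes, x = 1/16, t = 1/256):
as x → 0⁺, −log Z^Λ_x = (−log x)·d_Λ + O(1) with d_Λ the INDUCED graph metric, and site sets with ≥
2 holes realise theta/K_(2,3) metrics,
which are not of negative type. The refutation is topological and never touched the deciding theorem
(the umbrella was support); the
line MOVES rather than dies: (a) every positivity statement is now made on convex lattice domains
only — their induced graphs have
unit-square inner faces (a larger face would enclose a lattice point of conv Λ ⊆ K missing from Λ),
i.e. squaregraph blocks and trees,
median graphs, isometrically ℓ¹ (arXiv:0905.4537), so the leading-order kernel (−log x)·d_Λ IS of
negative type and the refuting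
mechanism is provably absent; this is also exactly the class the engine ConvexMetricUpgrade
consumes; (b) the three-point shadow stays load-bearing
because it is the weakest form the engine needs and is blind to 5-point obstructions on ANY Λ (√ of
a metric is a metric: slack
2√(d(a,b)d(b,c))·log(1/x) at small x); near x_c its binding triples are adjacent collinear BULK
sites, i.e. the lattice-scale inequality
G_x(2e₁) ≥ G_x(e₁)⁴ (series/transfer-matrix estimates 0.46–0.65 vs 0.42–0.43 at x_c; 0.41 vs 0.13 at
the certified 0.3711; 0 violations
on every domain ≤ 144 sites incl. the theta/annulus/holey-ladder gadgets that kill the umbrella);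
(c) the observed drift of the
positive-type thresholds onto x_c (strips x**(w) − x_c ≈ 0.38 w^(−4/3), boxes 0.556 L^(−4/3), w, L ≤
7) is the finite-size crossover
L ≈ ξ(x) ∝ (x − x_c)^(−ν), ν = 3/4 — forced by supercriticality above x_c, hence NOT evidence of
marginality; the honest margins are
spectral: λ_min(Z^Λ_(x_c)) ≈ 0.43 on the gadgets, bulk limit inf_k Ĝ_(x_c)(k) = χ(−x_c) ≈ 0.11–0.15
> 0; CND margin of −log Z^Λ_(x_c)
0.33 → 0.177 from 6 to 30 sites; (d) the t = 1 / lace branch (PlanarLaceSummability → LaceToPosDef →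
positive definiteness for all Λ)
is PARKED: it never fed the metric (PD does not give the triangle inequality) and the unsigned
planar lace series is numerically
SUSPECT-FALSE at x_c (U_m(0) x_c^m ≈ m^(−0.84), m ≤ 18, evidence LaceGrowth8260.md on
stmt-CriticalPhenomena-8260). Retained as support:
the all-Λ MetricTriangle (stmt-CriticalPhenomena-8258, the mechanism-free stronger form with its
33-note numerical dossier; it implies
(CMT) by instantiation).
Lean: `ConvexMetricTriangle ∧ AveragedTubeMass ∧ AnnularMassDecay ∧ SubseqIdentification`

## Assembly
Deciding theorem `closes` (rev 2; the rev-1 term with ConvexMetricTriangle / ConvexMetricUpgrade in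
place of MetricTriangle / MetricUpgrade, lean rc 0 in the
planner's Sketch.lean): `theorem closes (CMT : ConvexMetricTriangle) (Avg : AveragedTubeMass)
(ConvexMetricUpgrade) (AMD : AnnularMassDecay)
(SurgeryReduction) (TightOfShellCrossing) (I : SubseqIdentification) (TightIdentificationCriterion)
: SAWScalingLimit := fun D a b hab => …`:
ConvexMetricUpgrade CMT Avg : TubeLowerBound; SurgeryReduction AMD _ : ShellCrossingBound;
TightOfShellCrossing _ : EventualTight, whose δ₀ and
IsTightMeasureSet on (0, δ₀] feed, together with (I) at (D, a, b), TightIdentificationCriterion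
(stmt-CriticalPhenomena-10873, the SAW
germ form of the Prokhorov/Billingsley criterion, provable now from
Literature.Probability.RandomPlanarGeometry.convergesInLawToSLE_of_isTightMeasureSet_image +
IsSLECurve.map_eq_holds after clamping
SAW.law to probability measures off the germ), which yields ConvergesInLawToSLE (8/3) D =
SAWScalingLimit unfolded at (D, a, b). The
`Assembly` item is restated to the exact type of `closes` (pure logic, `theorem Assembly_holds :
Assembly := closes`).

Rationale: WHY THIS LINE. Every route of this sub-problem stalls on precompactness, and the renewal-tightness
line (route SAWRenewalTightness) isolates the
missing lower bound as TubeLowerBound: a POINTWISE polynomial lower bound for point-to-point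
x_c-masses in a tube, of which MadrasSlade1993
(p. 202 of the held copy) says "we are not aware of any rigorous lower bound of the form q_N ≥ const
N^(−p) μ^N" — classical lower bounds are
exponential-scale (b_n ≥ μ^n e^(−C√n)) and the one polynomial lower bound in print, B_T ≥ c/T on the
hexagonal lattice (DuminilCopinSmirnov2012,
BeatonBousquetMelouDeGierDuminilCopinGuttmann2014), is AVERAGED over the exit point and uses the
parafermion. The card
edge-of-positive-type-polymer-kernel found by exact enumeration that the polymer kernel is positive
definite and even infinitely divisible on
every box ≤ 6×6 up to x_c; infinite divisibility makes √(−log Z) a metric (BergChristensenRessel1984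
Ch. 3 Thm 2.2, Prop. 3.2; Bhatia2006; both
facts PROVED in tree, Literature/Analysis/Matrix/SchoenbergKernelsProofs.lean), and a metric
converts region-averaged lower bounds into
pointwise ones with only polynomial loss across a geometric tower of scales ℓ, ℓ^α, ℓ^(α²), … — a
"reverse Simon–Lieb inequality up to
polynomial factors" that no sub/super-multiplicativity of SAW counts provides (Hammersley–Welsh,
Kesten1963SAW give exponential-scale gluing
only). ROUTE CHOICE (rev 2): the all-Λ umbrella died on multiply connected site sets by a
topological mechanism (induced theta/K_(2,3) metrics
are not of negative type; Theorems/SAWEdgeOfPositiveTypeInfiniteDivisibilityRefutation.lean), so the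
line is redrawn on CONVEX LATTICE DOMAINS
— traces K ∩ ℤ² of convex K, whose induced graphs are squaregraph-and-tree median graphs,
isometrically ℓ¹ (arXiv:0905.4537), hence of
negative type at leading order — which is simultaneously the class where the refuting mechanism is
provably absent, the class the engine
consumes (tubes are closed thickenings of segments), and the class all certified numerics cover
(boxes ≤ 7×7, strips w ≤ 7 × 24, every ≤
10-cell polyomino, rectangles ≤ 30 sites with CND margin ≥ 0.177). Imported areas: harmonic analysis
on semigroups / Schoenberg's
negative-type theory (the metric), matrix analysis (infinitely divisible kernels, Horn
doi:10.1090/s0002-9947-1969-0499938-6), metric graph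
theory (median graphs / squaregraphs are ℓ¹), and the Aizenman–Burchard precompactness technology
(AizenmanBurchardDuke1999,
KemppainenSmirnov2017) through the shared items. What it does that prior routes do not:
SAWLeftRightFKG bets on an FKG inequality and a
one-curve RSW scheme, SAWRenewalTightness on Kesten's renewal identity for BOTH the upper and the
pointwise lower bound; here the pointwise
lower bound is split into an averaged statement (the natural output of renewal/bridge arguments)
plus a positivity-driven upgrade; the
negatives index (stmt-CriticalPhenomena-0772 all-δ tightness; stmt-CriticalPhenomena-8261 all-Λ
infinite divisibility) is honoured: the
assembly uses EventualTight (stmt-1372) and every positivity statement carries the convexity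
hypothesis that excludes the 8261 witness class.

RANKED CRUXES. #2 ConvexMetricTriangle (crux, LOAD-BEARING) — for every convex K ⊂ ℂ, every finite Λ
with z ∈ Λ ↔ z ∈ K, every x ∈ [0, x_c]
and all a, b, c ∈ Λ with Z^Λ_x(a,b), Z^Λ_x(b,c) > 0: √(−log Z^Λ_x(a,c)) ≤ √(−log Z^Λ_x(a,b)) +
√(−log Z^Λ_x(b,c)). (why it might fail: no
mechanism of its own; near x_c the binding triples are adjacent collinear bulk sites, i.e. the
lattice-scale inequality G_x(2e₁) ≥ G_x(e₁)⁴,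
true at x_c only by a non-universal margin (estimates 0.46–0.65 vs 0.42–0.43) that certified
numerics cannot reach at x = x_c exactly.)
[BergChristensenRessel1984, MadrasSlade1993, item stmt-CriticalPhenomena-8258 dossier:
SAWStripEdgeTM.md, SAWPosTypeNumerics.md]
#3 AveragedTubeMass (crux) — there are α < 1, C, c > 0 such that for all u, v ∈ ℤ² and ℓ ≥ 1 with |u
− v| ≤ ℓ, the x_c-mass of
self-avoiding walks from u whose vertices stay within distance ℓ/10 + 2 of the segment [u, v] and
whose endpoint lies within distance ℓ^α
of v is ≥ c ℓ^(−C) — the mesoscopically averaged weakening of TubeLowerBound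
(stmt-CriticalPhenomena-4730). (why it might fail: needs a
polynomial lower bound for CONFINED critical masses on ℤ², an RSW-type input; classical bounds are
exponential-scale; hex has B_T ≥ c/T only
through the parafermion.) [MadrasSlade1993, DuminilCopinSmirnov2012,
BeatonBousquetMelouDeGierDuminilCopinGuttmann2014, DuminilCopinHammond2013,
Kesten1963SAW]
#4 ConvexInfiniteDivisibility (crux, the Schoenberg branch; NOT in `closes`) — for every convex K,
finite Λ = K ∩ ℤ², x ∈ [0, x_c] and t >
0 the Hadamard power (Z^Λ_x(u,v)^t)_(u,v ∈ Λ) is positive definite (⇔ −log Z^Λ_x conditionally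
negative definite on each component): the
repaired umbrella on the class where the x → 0⁺ obstruction vanishes; implies #2 by
SchoenbergToMetric; supersedes RectangleInfiniteDivisibility
(stmt-10892, rectangles are convex traces). (why it might fail: no mechanism; thresholds x**(w),
x**(L) → x_c⁺ only by finite-size scaling,
so the margin lives in the CND eigenvalue (0.33 → 0.177 from 6 to 30 sites, decreasing) whose bulk
limit — positivity of the Lévy measure
of −log G_(x_c) on ℤ², staggered mode included — is unmeasured.) [BergChristensenRessel1984,
Bhatia2006,
doi:10.1090/s0002-9947-1969-0499938-6, arXiv:0905.4537,
Summit.CriticalPhenomena.SAWScalingLimit.Theorems.SAWEdgeOfPositiveTypeInfiniteDivisibility_refuted,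
evidence rect_cnd.py / SAWStripEdgeTM.md]
#5 AnnularMassDecay (crux) — (shared verbatim with route SAWRenewalTightness,
stmt-CriticalPhenomena-4729) θ > 0, C with the x_c-mass of
annular in-crossings from |u − z| ≥ R to |· − z| ≤ r bounded by C (r/R)^θ. (why it might fail:
curvature kills the exact renewal
decomposition; θ > 0 is a radial form of 'bridge partition function of height T → 0 polynomially at
x_c', open on ℤ²; even θ = 0 is
unproved.) [Kesten1963SAW, MadrasSlade1993, arXiv:2310.17299, arXiv:1109.0358, GlazmanManolescu2019,
LawlerSchrammWerner2004SAW]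
#6 SubseqIdentification (crux) — (shared verbatim, stmt-CriticalPhenomena-0783) every probability
measure on CurveClass ℂ that is a weak
limit of the SAW laws along some s_n → 0+ is the chordal SLE_(8/3) law in D; not this route's
mechanism, staffed through the routes that
own it. (why it might fail: unconditional over arbitrary subsequential μ; print gives SLE_8/3 only
IF the limit is conformally covariant; on
ℤ² no observable; embedding-blind inputs cannot produce rotation covariance
(EmbeddingModulusUniqueness).) [LawlerSchrammWerner2004SAW,
LawlerSchrammWerner2003Restriction, DuminilCopinSmirnov2012,
Literature.Barriers.CriticalPhenomena.EmbeddingModulusUniqueness]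
#9 SchoenbergToMetric (support, provable now, M) — ConvexInfiniteDivisibility →
ConvexMetricTriangle: restrict the Hadamard-power matrix
to the component C ∋ a, b, c of Λ's induced graph (all entries > 0 there for x > 0; principal
submatrices of positive definite matrices are
positive definite), pass from Matrix.PosDef on the subtype to
Literature.Analysis.Matrix.IsPosDefKernel, and apply
sqrt_neg_log_triangle_of_rpow_posDef with Schoenberg1938_negDef_iff_exp_posDef_holds and
BCR1984_sqrt_negDef_semimetric_holds (x = 0 forces a =
b = c). [BergChristensenRessel1984, Literature.Analysis.Matrix.sqrt_neg_log_triangle_of_rpow_posDef]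
#9 ConvexMetricUpgrade (support, stmt-CriticalPhenomena-13964, replaces MetricUpgrade stmt-8264 in
rev 2; provable now, M) — ConvexMetricTriangle →
AveragedTubeMass → TubeLowerBound: the tower argument of the thesis; the tube site set is finite and
is the trace of K = Metric.cthickening (ℓ/10+2) (segment ℝ u v), convex by Convex.cthickening;
(CMT)'s positivity hypotheses hold by pigeonhole (u → v*) and a staircase (v* → v); split the case α
≤ 0; Z ≥ 1 makes the bound trivial so
the √ junk never matters. [BergChristensenRessel1984, MadrasSlade1993, stmt-CriticalPhenomena-4730]
#9 MetricTriangle (support since rev 2; stmt-CriticalPhenomena-8258) — the all-Λ form (no convexity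
hypothesis): strictly stronger than #2
(instantiate K), mechanism-free now that its umbrella is refuted, numerically robust on every Λ ≤
144 sites incl. the 8261 gadgets; kept as
the statement of record for refuters and because a proof of it discharges #2 in one line.
#9 TubeLowerBound, ShellCrossingBound, SurgeryReduction, TightOfShellCrossing, EventualTight
(support, shared verbatim with
SAWRenewalTightness: stmt-4730, 4728, 4731, 4732, 1372) — the surgery chain and the PROVED
Aizenman–Burchard criterion
(isTightMeasureSet_of_traversalBounds). [AizenmanBurchardDuke1999, KemppainenSmirnov2017,
DuminilCopinHammond2013, Kesten1987]
#9 TightIdentificationCriterion (support, stmt-CriticalPhenomena-10873, provable now, M) — the SAW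
germ form of Prokhorov/Billingsley, last
hypothesis of `closes`.
[Literature.Probability.RandomPlanarGeometry.convergesInLawToSLE_of_isTightMeasureSet_image,
BillingsleyCPM1999]
#1 Assembly (restated rev 2 to the exact type of `closes`). DROPPED in rev 2: MetricUpgrade
(stmt-8264, the engine with the all-Λ antecedent —
superseded by ConvexMetricUpgrade); PlanarLaceSummability (stmt-8260) and LaceToPosDef (stmt-8263)
— never in `closes`, positive definiteness at t = 1 does not give the triangle inequality, and the
unsigned planar lace series is
numerically suspect-false at x_c (LaceGrowth8260.md: U_m(0) x_c^m ≈ m^(−0.84), m ≤ 18);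
RectangleInfiniteDivisibility (stmt-10892) —
superseded by #4. DROPPED in rev 1: InfiniteDivisibility (stmt-8261, REFUTED), TriangleOfID
(stmt-8262), the stale tail stmt-4538.

TWO-LAYER PLAN. No split filed (D-0019: not before a crux closes). The Schoenberg branch is an
ALTERNATIVE SUFFICIENT CRUX for #2, wired by
the support SchoenbergToMetric, not a decomposition of it. Foreseen glued splits:
ConvexInfiniteDivisibility ⇐ (StripEdges: for every width w
the infinite-strip kernel Z^(ℤ×[0,w))_x is infinitely divisible for x ≤ x_c — a transfer-matrix
statement per w, target mode = staggered
(π,π)) → (StripToConvex: monotonicity/exhaustion of CND margins in nested convex pieces, as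
observed) → #4. AveragedTubeMass ⇐
(SquareCrossingMass: the x_c-mass of confined crossings of an s × s square, entry fixed, exit free,
is ≥ s^(−C′)) → (Concatenate: ten squares
along the tube, endpoint matching by pigeonhole costs s^(−2) per junction) → #3.
ConvexMetricTriangle ⇐ (BulkTriple: G_x(2e₁) ≥ G_x(e₁)⁴·(1+η)
at x ≤ x_c in infinite volume) → (BoundaryRelief: boundary and non-collinear triples have slack ≥
the bulk one) → #2 — only if a structural
handle on the bulk triple appears.

KILL CRITERIA. ¬ConvexMetricTriangle by ONE certified triple in ONE convex lattice domain (a box or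
tube) at a rational x ≤ 1/2.695 ≤ x_c
(tree: connectiveConstant_le_2695; integer length polynomials + interval arithmetic) CLOSES THE
ROUTE — there is no weaker form the engine can
use. ¬ConvexInfiniteDivisibility (certified, or `refuted:` with a transfer-matrix evidence file
showing the CND margin of −log Z^Λ_x crossing
0 on growing boxes/strips at some x ≤ x_c) breaks NOTHING in `closes`: pre-declared repair = drop #4
and SchoenbergToMetric, the line reverts
to the mechanism-free #2 (no BROKEN drama needed beyond that edit). ¬MetricTriangle (support, all Λ)
on a NON-convex Λ: drop it, no effect on
the line; on a convex Λ it is ¬#2. ¬AveragedTubeMass (a stretched-exponential upper bound for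
confined tube masses at x_c) kills this route
AND TubeLowerBound of SAWRenewalTightness. ¬AnnularMassDecay breaks both routes' surgery chain
(pivot: feed TubeLowerBound into
SAWLeftRightFKG's one-curve RSW scheme instead). Refutation of SubseqIdentification kills the
conjunct for everyone. TubeLowerBound proved
elsewhere (directly) moots #2 + #3 as tightness inputs but not as structural statements.

NOT DECOMPOSED YET. Deliberately not filed: infinite divisibility for general HOLE-FREE (simply
connected, non-convex) Λ — same leading-order
immunity (squaregraph metrics), more falsifiable, not needed; the support MetricTriangle →
ConvexMetricTriangle (a one-line instantiation,
`convexMT_of_MT` in the planner's Sketch.lean — whoever proves stmt-8258 lands #2 with it); the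
PARKED t = 1 branch (positive definiteness of
Z^Λ_x for all finite Λ, x ≤ x_c — alive numerically: λ_min ≈ 0.43 on the theta gadgets, χ(−x_c) ≈
0.11–0.15 in the bulk — and its lace
mechanism, dropped this rev with the suspect-false evidence; re-file only with a new mechanism);
infinite-volume positive type (Bochner form,
Ĝ_x(k) ≥ 0; at k = (π,π) it reads χ(−x) > 0) and infinite-volume infinite divisibility
(Lévy–Khintchine form of −log G_x on ℤ²: the bulk
limit of #4 and its cheapest honest test); the UnitBound Z^Λ_(x_c)(u,v) < 1 (now a COROLLARY of #4
via Schoenberg: ψ = −log Z ≥ 0; numerically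
G_(x_c)(e₁) ≈ 0.81); the zero-free-disc (Lee–Yang) form det Z^Λ_x ≠ 0 on |x| ≤ x_c; the
near-critical variant of ConvexMetricUpgrade (metric at x
< x_c, averaged mass at x_ℓ ↑ x_c in the critical window); the hexagonal model case (where B_T ≥ c/T
is a theorem and Avg is within reach of
the finite-domain parafermionic identity); constants (α = 1/2 is what the recursion likes; the tube
width 1/10 is inherited from stmt-4730).
Layer-2 children only after #2, #3 or #4 moves.

CHEAPEST FALSIFIER. THE BULK TRIPLE. Near x_c (CMT) on large convex domains is decided by adjacent
collinear bulk sites: Z(a,c) ≥ Z(a,b)²Z(b,c)²,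
whose infinite-volume form is G_x(2e₁) ≥ G_x(e₁)⁴. G_x(e₁) is a POLYGON series, c_n(0→e₁) =
(n+1)p_(n+1)/2 with p_N known far beyond need
(G_(x_c)(e₁) ≈ 0.81, tail ∝ N^(−3/2), amplitude Bμ/2 ≈ 0.742); c_n(0→2e₁) = 1, 6, 20, 92, 468, 2532,
14220 (n = 2…14, refuter g41-33; kit
j000466 to n ≤ 25) gives G_(x_c)(2e₁) between 0.46 (partial sums, rising) and ≈ 0.65
(tail-corrected) against G_(x_c)(e₁)⁴ ≈ 0.42–0.43. Run:
(i) extend c_n(0→2e₁) to n ≈ 40 (transfer matrix / two-point enumeration, hours off-box) and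
tail-fit with the N^(−3/2) law — a tail-corrected
ratio G(2e₁)/G(e₁)⁴ < 1 at x_c is the alarm, and a CERTIFIED Z^Λ(0,2e₁) < Z^Λ(0,e₁)⁴ at the centre
of one big box at rational x ≤ 1/2.695 =
0.3711 is the kill (currently 0.41 vs 0.13 there: a factor 3 of room, because G_x(e₁) has a √(x_c −
x) drop below x_c); (ii) for #4, the CND
eigenvalue of −log Z^Λ_(x_c) on L × L boxes and w × n strips, L, w = 6…10 by the frontier transfer
matrix (kit j000598 already covers the
w = 8, 9 edges): extrapolate the margin (0.33 → 0.177 up to 30 sites) in 1/L; a fit through 0 at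
finite L is the alarm, a certified
negative Hadamard-power form on one rectangle at x ≤ 0.3711 the kill (of #4 only). STATUS carried
over: strip edges x**(w) = 0.526, 0.468,
0.4385, 0.4244, ≈0.415, ≈0.409 (w = 2…7), box edges x_c + 0.556·L^(−4/3) (L ≤ 7) — all ONTO x_c as
finite-size scaling dictates, first
non-PD direction = staggered (π,π) mode, χ(−x_c) ≈ +0.11–0.15 > 0 in infinite volume, so any failure
is boundary-driven or
infinite-divisibility-specific; (CMT)/(MT) slack ≥ 0.45 in √F units on every domain ≤ 144 sites, 0
violations anywhere at x ≤ 0.43.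

NUMBERS. x_c = 1/μ, μ = 2.63815853 (x_c = 0.379052); in tree 2.6 ≤ μ ≤ 2.695
(le_connectiveConstant_26, connectiveConstant_le_2695) and 1/3 ≤
x_c (SAW.one_third_le_criticalFugacity). Thresholds (PD x*, ID x**): boxes x* = 0.5203, 0.4964,
0.4716, 0.4592, 0.4463, 0.4392, 0.4316 (3×3 …
6×6), x** = 0.5163, 0.4687, 0.4442, 0.4301, 0.4208 (3×3, 4×4 … 7×7); strips x**(w) = 0.526, 0.468,
0.4385, 0.4244, ≈0.415, ≈0.409 (w = 2…7),
x* ≈ x** + 0.002, MT onset x*** = x** + 0.006–0.009; crossover amplitudes (x** − x_c)·L^(4/3) ≈ 0.38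
(strips), 0.56 (boxes), stable and
positive. Margins at x_c: λ_min(Z^Λ) = 0.30 … 0.21 (3×3 … 6×5), ≈ 0.43–0.48 on theta gadgets ≤ 130
sites; CND eigenvalue of the centred
log-kernel 0.331 (2×3), 0.261 (3×3), 0.236 (3×4), 0.211 (4×4), 0.224 (3×5), ≥ 0.177 (5×6);
λ_min(Z^∘t)/t ≥ 0.177 on rectangles ≤ 30 sites,
t ↓ 1/128; MT slack (√F units) 0.512, 0.500, 0.491, 0.479, 0.475, 0.471 (3×3 … 6×6), ≈0.45 at the
9×9 centre, infinite-volume ≈ 0.04–0.15.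
Two-point values: G_(x_c)(e₁) ≈ 0.806–0.81 (polygon series to N = 42 + tail); G_(x_c)(2e₁) ≈
0.46↑–0.65; χ(−x) ≈ 0.41, 0.33, 0.28, 0.23,
0.20, 0.17, 0.11–0.15 at x = 0.25, 0.30, 0.33, 0.35, 0.36, 0.37, x_c. Refuting certificate (8261):
theta(8,2), x = 1/16, t = 1/256,
bᵀZ^(∘t)b = −0.0196; smallest numerical witness Λ₁₃ = ∂([0,2]×[0,4]) ∪ {(1,2)} at x = 1/10, t =
1/100. Lace data (parked branch): unsigned
U_m(0) x_c^m = 0.119, 0.103, 0.090, 0.081 (m = 10…16 even), local exponent ≈ −0.84 at m = 18. SLE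
side: boundary exponent 5/8, bulk η = 5/24
(LawlerSchrammWerner2004SAW) — the predicted continuum kernels (−(5/8) log H_Ω on the boundary,
|u−v|^(−5/24) in the bulk) are of negative /
positive type respectively (log-kernel and Riesz kernels in the plane), consistent with (CMT) and
with #4 at large scales.

DEFINITION REQUESTS. None: the polymer kernel is inlined with
Literature.Probability.RandomPlanarGeometry.SAW.Zd.sawFun (a `let` in each
statement); convexity is Mathlib's `Convex ℝ K` on K : Set ℂ with the trace condition `∀ z, z ∈ Λ ↔
Site.toComplex z ∈ K`. A named
`SAW.domainKernel Λ x u v` would shorten five statements; file it only if a grounder asks.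

Novelty: Searches (2026-08-15, rev 0/1, kept): `lit search --hybrid "infinitely divisible matrix Hadamard
power positive definite kernel negative type Schoenberg"` (8: BergChristensenRessel1984 pp.77–85,
Horn–Johnson, Guichardet 1972/2014, …); `lit search --hybrid "Griffiths inequality triangle
inequality logarithm correlation metric two-point function"` (6: Glimm–Jaffe 1987, Lieb, Lavis–Bell
— the Ising −log⟨σσ⟩ metric via Griffiths II, which SAW lacks); `lit search "partition function
zeros self-avoiding walks finite lattice fugacity" --source zbmath` (0); `lit search "infinitely
divisible kernel correlation function lattice model positive definite two-point" --source crossref`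
(7: Horn 1969 doi:10.1090/s0002-9947-1969-0499938-6, Guichardet 1972, Parthasarathy 1970, Schmidt
1972); `lit galaxy search "self-avoiding walk two-point function positive definite" --star all` (0
rows); `lit galaxy search "partition function zeros self-avoiding walk" --star all` (0 rows); `lit
galaxy search "infinitely divisible matrices" --star all` (12: Horn–Johnson Topics, Khare, BCR,
Berman–Shaked-Monderer); `lit read MadrasSlade1993` pp. 36, 69, 202; `lit read arXiv:1206.2092` p.
6. Rev 2 (route choice, 2026-08-15T23Z): `lit search --hybrid "median graph isometric embedding
hypercube l1 negative type squaregraph"`, `lit search "infinitely divisible matrices Horn 1969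
Hadamard powers positive definite" --source local`, `lit search "squaregraphs median graphs Bandelt
Chepoi Eppstein"` — searchd unavailabl  [refs: 10.1090/s0002-9947-1969-0499938-6, 1206.2092, 0905.4537, doi:10.1090/s0002-9947-1969-0499938-6, BergChristensenRessel1984, MadrasSlade1993, Bhatia2006, HaraSlade1992]

Barriers (technique_class: positive-type hilbert-metric convex-domains precompactness): - technique_class: positive-type hilbert-metric convex-domains precompactness
- Literature.Barriers.CriticalPhenomena.SupercriticalSAWSpaceFilling: respected as a guard — every
positivity statement is for x ≤ x_c only (x*(Λ), x**(Λ) are finite for every box and fall onto x_c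
from above exactly as supercriticality forces), nothing is open in x, RobustSAWScalingLimit is not
entailed.
- Literature.Barriers.CriticalPhenomena.EmbeddingModulusUniqueness: all statements here are graph
statements (embedding-blind, shear-invariant), so the line can never produce rotation or conformal
covariance — EVADED BY SCOPE: it delivers precompactness (EventualTight through TubeLowerBound →
ShellCrossingBound) and imports identification (SubseqIdentification) from embedding-sensitive
routes; honest residue: without (I) the route proves tightness and subsequential limits, not the
conjunct.
- Literature.Barriers.CriticalPhenomena.LaceExpansionMeanField: no longer engaged — the
lace/positive-definiteness branch (PlanarLaceSummability, LaceToPosDef) is DROPPED in rev 2 (it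
never fed the metric, and the unsigned planar lace series is numerically suspect-false at x_c, which
is the barrier biting in its own way: no small parameter in d = 2); nothing in the route now passes
through a lace expansion.
- Literature.Barriers.CriticalPhenomena.SAWNoUnitaryCFT: positive type / infinite divisibility of
the symmetric Euclidean kernel (u,v) ↦ Z^Λ(u,v) is not unitarity / reflection positivity of a
transfer matrix

History (route lifecycle, newest last):
- 2026-08-15T16:57:29Z · rev 1: restated Assembly (stmt-CriticalPhenomena-8265) — route-repair (rbadge g2, glue + BROKEN): InfiniteDivisibility (stmt-8261) refuted SUBSTANTIVELY as 'every finite Λ' by Theorems/SAWEdgeOfPositiveTypeInfiniteDiv (planner-rbadge-CriticalPhenomena-SAWEdgeOfPosi-1eca7c5f-g2-0)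
- 2026-08-15T16:57:29Z · rev 1: dropped InfiniteDivisibility, TriangleOfID, stmt-CriticalPhenomena-4538 — route-repair (rbadge g2, glue + BROKEN): InfiniteDivisibility (stmt-8261) refuted SUBSTANTIVELY as 'every finite Λ' by Theorems/SAWEdgeOfPositiveTypeInfiniteDiv (planner-rbadge-CriticalPhenomena-SAWEdgeOfPosi-1eca7c5f-g2-0)
- 2026-08-15T16:57:29Z · REPAIRED (restate Assembly; drop InfiniteDivisibility, TriangleOfID, stmt-CriticalPhenomena-4538) — back to open: route-repair (rbadge g2, glue + BROKEN): InfiniteDivisibility (stmt-8261) refuted SUBSTANTIVELY as 'every finite Λ' by Theorems/SAWEdgeOfPositiveTypeInfiniteDiv (planner-rbadge-CriticalPhenomena-SAWEdgeOfPosi-1eca7c5f-g2-0)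
- 2026-08-15T23:27:53Z · rev 3: dropped PlanarLaceSummability, LaceToPosDef, RectangleInfiniteDivisibility — route-choice rev-2 package, step A: drop PlanarLaceSummability, LaceToPosDef (parked lace branch: not in closes, PD at t=1 does not give the metric, numerically (planner-rchoice-CriticalPhenomena-SAWEdgeOfPos-04104920-0)
- 2026-08-15T23:32:52Z · rev 5: restated Assembly (stmt-CriticalPhenomena-11296) — route-choice rev-2 package, step B2: closes switches to ConvexMetricTriangle/ConvexMetricUpgrade (same composition term, Sketch rc 0); drop MetricUpgrade (8264, (planner-rchoice-CriticalPhenomena-SAWEdgeOfPos-04104920-0)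
- 2026-08-15T23:32:52Z · rev 5: dropped MetricUpgrade — route-choice rev-2 package, step B2: closes switches to ConvexMetricTriangle/ConvexMetricUpgrade (same composition term, Sketch rc 0); drop MetricUpgrade (8264, (planner-rchoice-CriticalPhenomena-SAWEdgeOfPos-04104920-0)
- 2026-08-16T02:18:22Z · AUTO-CRUX: 1 conjecture-grade item(s) promoted to crux (MetricTriangle) — refuter vetting / tiering apply (operator:999:1362873)
- 2026-08-26T04:18:30Z · DORMANT — reconciler: no traction for 8.3 d (last activity item-evidence-added at 2026-08-17T19:24:59Z); parked, not closed — `ledger route dormant route-CriticalPhenomen (operator:999:1972258)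

sub-problem: SAWScalingLimit · status: dormant · opened planner-plancard-CriticalPhenomena-SAWScaling-cb5461ae-0 2026-08-15T12:35:58Z · rev 7 · ledger route-CriticalPhenomena-SAWEdgeOfPositiveType
GENERATED by the gate from the ledger (D-0016/17). Provers cite these decls: `theorem foo : Summit.CriticalPhenomena.SAWScalingLimit.Theses.SAWEdgeOfPositiveType.<Decl> := …` in Summits/CriticalPhenomena/SAWScalingLimit/Theorems/<Name>.lean.
-/

namespace Summit.CriticalPhenomena.SAWScalingLimit.Theses.SAWEdgeOfPositiveType

open scoped BigOperators Topology Manifold Classical MeasureTheory ProbabilityTheory Matrix InnerProductSpace ComplexConjugate ContinuousMap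
open Filter Set Function TopologicalSpace MeasureTheory

attribute [summit_statement] _root_.SAWScalingLimit

/-- item stmt-CriticalPhenomena-13962 · crux · rank 2 · open · by planner
why it might fail: No mechanism of its own; near x_c the binding triples are adjacent collinear BULK sites, i.e. the lattice-scale inequality G_x(2e₁) ≥ G_x(e₁)⁴, true at x_c only by a non-universal margin (est. 0.46–0.65 vs 0.42–0.43) that certified numerics cannot reach at x = x_c exactly.
sources: BergChristensenRessel1984, MadrasSlade1993, arXiv:0905.4537, Summits/CriticalPhenomena/SAWScalingLimit/Ideas/edge-of-positive-type-polymer-kernel.md, route-CriticalPhenomena-SAWEdgeOfPositiveType item stmt-CriticalPhenomena-8258 (dossier SAWStripEdgeTM.md, SAWPosTypeNumerics.md), pdf:8151004788795986840 (Seemann–Moulton–Stadler–Hellmuth 2023, planar median graphs: square-graphs are median)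
[crux] (LOAD-BEARING, rev 2 route choice) for every convex K ⊂ ℂ and every finite Λ ⊂ ℤ² that is its
lattice trace (z ∈ Λ ↔ z ∈ K), every x ∈ [0, x_c] and all a, b, c ∈ Λ with Z^Λ_x(a,b), Z^Λ_x(b,c) >
0: √(−log Z^Λ_x(a,c)) ≤ √(−log Z^Λ_x(a,b)) + √(−log Z^Λ_x(b,c)) — the polymer free energy restricted
to a CONVEX LATTICE DOMAIN is the square of a semimetric. Exactly what MetricUpgrade consumes (tubes
T(u,v,ℓ) are closed thickenings of segments, Convex.cthickening); the three-point Schoenberg shadow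
of ConvexInfiniteDivisibility (via SchoenbergToMetric) and the convex instance of the all-Λ support
MetricTriangle (stmt-8258). Why this class: the refutation of the all-Λ umbrella (stmt-8261) is
topological (induced theta/K_(2,3) metrics of ≥ 2-hole site sets are not of negative type); convex
traces have squaregraph-and-tree induced graphs (a non-square inner face would enclose a lattice
point of conv Λ ⊆ K missing from Λ), median hence ℓ¹ (arXiv:0905.4537), so the leading-order kernel
(−log x)·d_Λ is of negative type there — and the 3-point form is blind to 5-point obstructions on
any Λ anyway (√ of a metric is a metric). Junk audit as for stmt-8258: Z ≤ G_(x_c)(e₁) ≈ 0.81 < 1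
numerical -/
@[route_item "route-CriticalPhenomena-SAWEdgeOfPositiveType", crux]
def ConvexMetricTriangle : Prop :=
  ∀ (K : Set ℂ), Convex ℝ K → ∀ (Λ : Finset (Literature.Probability.LatticeModels.Site 2)), (∀ z : Literature.Probability.LatticeModels.Site 2, z ∈ Λ ↔ Literature.Probability.LatticeModels.Site.toComplex z ∈ K) → ∀ (x : ℝ), 0 ≤ x → x ≤ Literature.Probability.RandomPlanarGeometry.SAW.criticalFugacity → ∀ (a b c : Literature.Probability.LatticeModels.Site 2), a ∈ Λ → b ∈ Λ → c ∈ Λ → let Z : Literature.Probability.LatticeModels.Site 2 → Literature.Probability.LatticeModels.Site 2 → ℝ := fun u v => ∑ n ∈ Finset.range Λ.card, ∑ _ω ∈ (Literature.Probability.RandomPlanarGeometry.SAW.Zd.sawFun 2 n (v - u)).filter (fun ω => ∀ i ≤ n, u + ω i ∈ Λ), x ^ n; 0 < Z a b → 0 < Z b c → Real.sqrt (-Real.log (Z a c)) ≤ Real.sqrt (-Real.log (Z a b)) + Real.sqrt (-Real.log (Z b c))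

/-- item stmt-CriticalPhenomena-8258 · crux (kind.auto-crux: conjecture-grade) · rank 2 · open · by planner
why it might fail: Stronger than needed and mechanism-free: on exotic non-convex Λ near x_c nothing but numerics (≤ 144 sites) supports it; binding bulk triple G_x(2e₁) ≥ G_x(e₁)⁴ as for the convex form.
sources: BergChristensenRessel1984, MadrasSlade1993, Summits/CriticalPhenomena/SAWScalingLimit/Ideas/edge-of-positive-type-polymer-kernel.md
[crux] for every finite Λ ⊂ ℤ², every x ∈ [0, x_c] and all a, b, c ∈ Λ with Z^Λ_x(a,b), Z^Λ_x(b,c) >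
0: √(−log Z^Λ_x(a,c)) ≤ √(−log Z^Λ_x(a,b)) + √(−log Z^Λ_x(b,c)) — the polymer free energy is the
square of a metric (card Conjecture PT, three-point shadow of infinite divisibility; the
load-bearing form). [difficulty: open-problem] -/
@[route_item "route-CriticalPhenomena-SAWEdgeOfPositiveType"]
def MetricTriangle : Prop :=
  ∀ (Λ : Finset (Literature.Probability.LatticeModels.Site 2)) (x : ℝ), 0 ≤ x → x ≤ Literature.Probability.RandomPlanarGeometry.SAW.criticalFugacity → ∀ (a b c : Literature.Probability.LatticeModels.Site 2), a ∈ Λ → b ∈ Λ → c ∈ Λ → let Z : Literature.Probability.LatticeModels.Site 2 → Literature.Probability.LatticeModels.Site 2 → ℝ := fun u v => ∑ n ∈ Finset.range Λ.card, ∑ _ω ∈ (Literature.Probability.RandomPlanarGeometry.SAW.Zd.sawFun 2 n (v - u)).filter (fun ω => ∀ i ≤ n, u + ω i ∈ Λ), x ^ n; 0 < Z a b → 0 < Z b c → Real.sqrt (-Real.log (Z a c)) ≤ Real.sqrt (-Real.log (Z a b)) + Real.sqrt (-Real.log (Z b c))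

/-- item stmt-CriticalPhenomena-8259 · crux · rank 3 · open · by planner
why it might fail: Needs a polynomial lower bound for CONFINED critical masses on ℤ² (an RSW-type lower bound): classical bounds are exponential-scale (b_n ≥ μ^n e^(−C√n); MadrasSlade1993 p.202 'no rigorous lower bound q_N ≥ const N^(−p) μ^N'); hex has B_T ≥ c/T only through the parafermion.
sources: MadrasSlade1993, DuminilCopinSmirnov2012, BeatonBousquetMelouDeGierDuminilCopinGuttmann2014, DuminilCopinHammond2013, Kesten1963SAW, route-CriticalPhenomena-SAWRenewalTightness item stmt-CriticalPhenomena-4730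
[crux] there are α < 1, C, c > 0 such that for all u, v ∈ ℤ² and ℓ ≥ 1 with |u − v| ≤ ℓ, the
x_c-mass of self-avoiding walks from u whose vertices stay within distance ℓ/10 + 2 of the segment
[u, v] and whose endpoint lies within distance ℓ^α of v is ≥ c ℓ^(−C) (some partial sum already
exceeds the bound) — the mesoscopically averaged weakening of TubeLowerBound (route
SAWRenewalTightness, stmt-CriticalPhenomena-4730). [difficulty: open-problem] -/
@[route_item "route-CriticalPhenomena-SAWEdgeOfPositiveType", crux]
def AveragedTubeMass : Prop :=
  ∃ α C c : ℝ, α < 1 ∧ 0 < c ∧ ∀ (u v : Literature.Probability.LatticeModels.Site 2) (ℓ : ℝ), 1 ≤ ℓ → dist (Literature.Probability.LatticeModels.Site.toComplex u) (Literature.Probability.LatticeModels.Site.toComplex v) ≤ ℓ → ∃ N : ℕ, c * ℓ ^ (-C) ≤ ∑ n ∈ Finset.range (N + 1), ∑ _ω ∈ (Literature.Probability.RandomPlanarGeometry.SAW.Zd.saws 2 n).filter (fun ω => (∀ i ≤ n, Metric.infDist (Literature.Probability.LatticeModels.Site.toComplex (u + ω i)) (segment ℝ (Literature.Probability.LatticeModels.Site.toComplex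 u) (Literature.Probability.LatticeModels.Site.toComplex v)) ≤ ℓ / 10 + 2) ∧ dist (Literature.Probability.LatticeModels.Site.toComplex (u + ω n)) (Literature.Probability.LatticeModels.Site.toComplex v) ≤ ℓ ^ α), Literature.Probability.RandomPlanarGeometry.SAW.criticalFugacity ^ n

/-- item stmt-CriticalPhenomena-13963 · crux · rank 4 · open · by planner
why it might fail: Repairs 8261 (two-hole theta/K₂,₃ traces: induced metric not of negative type as x→0⁺) by convexity — traces are ℓ¹ at leading order, 2nd order PD on boxes. Live risk: no mechanism at x≈x_c — CND margin of −log Z at x_c shrinks 0.35→0.10 (4→20 sites), bulk Lévy-measure limit unmeasured.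
sources: BergChristensenRessel1984, Bhatia2006, doi:10.1090/s0002-9947-1969-0499938-6, arXiv:0905.4537, Summit.CriticalPhenomena.SAWScalingLimit.Theorems.SAWEdgeOfPositiveTypeInfiniteDivisibility_refuted, route-CriticalPhenomena-SAWEdgeOfPositiveType item stmt-CriticalPhenomena-13963 (evidence SAW-ConvexCND.md by refuter g47-0; SmallX-ConvexID-audit.md by planner rrefute g1)
[crux] (Schoenberg branch, NOT in `closes`; supersedes RectangleInfiniteDivisibility stmt-10892) for
every convex K ⊂ ℂ, every finite lattice trace Λ of K, every x ∈ [0, x_c] and t > 0 the Hadamard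
power (Z^Λ_x(u,v)^t)_(u,v ∈ Λ) of the confined-SAW polymer kernel is positive definite —
equivalently −log Z^Λ_x is conditionally negative definite on each component, Z^Λ_x = E e^(i(X_u −
X_v)) for a centred Gaussian field, √(−log Z) a Hilbertian semimetric. The repaired umbrella on the
class where the x → 0⁺ obstruction of the 8261 refutation provably vanishes (convex traces:
squaregraph/median induced graphs, ℓ¹ metrics) and which all certified numerics cover: boxes ≤ 7×7
(x** = 0.5163 … 0.4208 > x_c), strips w ≤ 7 (x**(w) = 0.526 … ≈0.409, kit j000598 for w = 8, 9),
every ≤ 10-cell polyomino, rectangles ≤ 30 sites with CND margin ≥ 0.177 at x_c (refuters g41-50,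
g43-2). Implies ConvexMetricTriangle by the PROVED Schoenberg facts (support SchoenbergToMetric).
Refutation breaks nothing in `closes` (pre-declared repair: drop this item and SchoenbergToMetric).
Degenerate cases: Λ = ∅ (0×0, vacuous), x = 0 (identity), disconnected thin traces (block diagonal,
0^t = 0). [deps: none] [diffic -/
@[route_item "route-CriticalPhenomena-SAWEdgeOfPositiveType"]
def ConvexInfiniteDivisibility : Prop :=
  ∀ (K : Set ℂ), Convex ℝ K → ∀ (Λ : Finset (Literature.Probability.LatticeModels.Site 2)), (∀ z : Literature.Probability.LatticeModels.Site 2, z ∈ Λ ↔ Literature.Probability.LatticeModels.Site.toComplex z ∈ K) → ∀ (x t : ℝ), 0 ≤ x → x ≤ Literature.Probability.RandomPlanarGeometry.SAW.criticalFugacity → 0 < t → let Z : Literature.Probability.LatticeModels.Site 2 → Literature.Probability.LatticeModels.Site 2 → ℝ := fun u v => ∑ n ∈ Finset.range Λ.card, ∑ _ω ∈ (Literature.Probability.RandomPlanarGeometry.SAW.Zd.sawFun 2 n (v - u)).filter (fun ω => ∀ i ≤ n, u + ω i ∈ Λ), x ^ n; (Matrix.of fun p q : Λ => Z p.1 q.1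 ^ t).PosDef

/-- item stmt-CriticalPhenomena-4729 · crux · rank 5 · open · by planner
why it might fail: Curvature kills the exact renewal decomposition; θ>0 is a radial form of 'bridge partition function of height T → 0 polynomially at x_c', open on ℤ² (MadrasSlade1993 p.92; arXiv:2310.17299 p.2); hex only, via parafermion. Even θ=0 is unproved.
sources: Kesten1963SAW, MadrasSlade1993, arXiv:2310.17299, arXiv:1109.0358, GlazmanManolescu2019, LawlerSchrammWerner2004SAW
[crux] (card E1, SAW-RSW upper bound = annular mass conservation; lattice units on ℤ², scale-free)
there are θ > 0 and C such that for every centre z ∈ ℂ, radii 1 ≤ r < R and start vertex u with |u −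
z| ≥ R, the x_c-mass Σ x_c^{|ω|} over self-avoiding walks ω from u whose interior vertices lie in
the open annulus r < |· − z| < R and whose last vertex lies in |· − z| ≤ r ("annular bridges": the
radius is maximal at the start and minimal at the end, the exact analogue of Kesten's bridges, which
in a straight strip have x_c-mass u_L ≤ 1 by Σ_irr x_c^|β| = 1) is ≤ C (r/R)^θ (all partial sums;
x_c = SAW.criticalFugacity). [deps: KestenIdentity, StripMassConservation] [difficulty:
open-problem] -/
@[route_item "route-CriticalPhenomena-SAWEdgeOfPositiveType", crux]
def AnnularMassDecay : Prop :=
  ∃ θ C : ℝ, 0 < θ ∧ ∀ (z : ℂ) (r R : ℝ), 1 ≤ r → r < R → ∀ (u : Literature.Probability.LatticeModels.Site 2), R ≤ dist (Literature.Probability.LatticeModels.Site.toComplex u) z → ∀ N : ℕ, (∑ n ∈ Finset.range (N + 1), ∑ _ω ∈ (Literature.Probability.RandomPlanarGeometry.SAW.Zd.saws 2 n).filter (fun ω => (∀ i, 0 < i → i < n → r < dist (Literature.Probability.LatticeModels.Site.toComplex (u + ω i)) z ∧ dist (Literature.Probability.LatticeModels.Site.toComplex (u + ω i)) z < R) ∧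 dist (Literature.Probability.LatticeModels.Site.toComplex (u + ω n)) z ≤ r), Literature.Probability.RandomPlanarGeometry.SAW.criticalFugacity ^ n) ≤ C * (r / R) ^ θ

/-- item stmt-CriticalPhenomena-0783 · crux · rank 6 · open · by planner
why it might fail: Unconditional over arbitrary subsequential μ: print gives SLE_8/3 only IF the limit is conformally covariant (LSW04 Prediction 1); on ℤ² no observable; embedding-blind inputs (incl. this route's) cannot produce rotation covariance (EmbeddingModulusUniqueness).
sources: LawlerSchrammWerner2004SAW, LawlerSchrammWerner2003Restriction, DuminilCopinSmirnov2012, Literature.Barriers.CriticalPhenomena.EmbeddingModulusUniqueness, route-CriticalPhenomena-SAWParafermion item stmt-CriticalPhenomena-0783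
[crux] r3: identification of subsequential limits — for every Dobrushin domain D, endpoint
approximation (a_δ,b_δ), sequence s_n → 0+ and probability measure μ on CurveClass ℂ, if ∫ f∘curve
d(Literature.Probability.RandomPlanarGeometry.SAW.law D (s n) …) → ∫ f dμ for all bounded continuous
f then μ is the chordal SLE_{8/3} law in D (Literature.Probability.RandomPlanarGeometry.IsSLELaw
(8/3) D μ). Obtained from r2 (observable limit) by the martingale principle (LSW03
arXiv:math/0209343 Prop. 5.2: κ = 8/3 is singled out by the 5/8-observable), or from restriction
(sibling route). -/
@[route_item "route-CriticalPhenomena-SAWEdgeOfPositiveType", crux]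
def SubseqIdentification : Prop :=
  ∀ (D : Literature.Probability.RandomPlanarGeometry.DobrushinDomain) (a b : ℝ → Literature.Probability.LatticeModels.Site 2), Literature.Probability.RandomPlanarGeometry.SAW.IsEndpointApprox D a b → ∀ (s : ℕ → ℝ) (μ : MeasureTheory.Measure (Literature.Probability.RandomPlanarGeometry.CurveClass ℂ)), Filter.Tendsto s Filter.atTop (nhdsWithin 0 (Set.Ioi 0)) → MeasureTheory.IsProbabilityMeasure μ → (∀ f : BoundedContinuousFunction (Literature.Probability.RandomPlanarGeometry.CurveClass ℂ) ℝ, Filter.Tendsto (fun n => ∫ γ, f γ.curve ∂(Literature.Probability.RandomPlanarGeometry.SAW.law D.carrier (s n) (a (s n)) (b (s n)))) Filter.atTop (nhds (∫ x, f x ∂μ))) → Literature.Probability.RandomPlanarGeometry.IsSLELaw ((8 : NNReal) / 3) D μ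

/-- item stmt-CriticalPhenomena-10873 · support · rank 9 · closed · proved by Summit.CriticalPhenomena.SAWScalingLimit.Theorems.edgeOfPositiveType_tightIdentificationCriterion_proof @ 6c5f5409437e (prover) · by planner
[support] the SAW instance of the Prokhorov/Billingsley criterion along the germ at 0⁺,
self-contained (mentions no route decl, so it cannot be rendered BLOCKED like the shared tail
stmt-CriticalPhenomena-4538), with its two inputs in exactly the shapes of EventualTight
(∃δ₀-IsTightMeasureSet of the pushed-forward laws on (0, δ₀]) and SubseqIdentification (explicit
mesh sequences s n → 0⁺ and probability measures μ): tightness on (0, δ₀] ∧ every subsequential weak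
limit is the chordal SLE_(8/3) law ⇒ ConvergesInLawToSLE (8/3) D curve law. PROVABLE NOW (difficulty
M): if SAW.law were a probability measure at every δ this is literally Literature
convergesInLawToSLE_of_isTightMeasureSet_image with huniq := IsSLECurve.map_eq_holds and hY :=
SAW.aemeasurable_curve (checked: planner Sketch.lean, 7-line term); the real proof clamps: by
IsEndpointApprox.reachable, 0 < x_c < 1 (SAW.criticalFugacity_pos_lt_one′) and finiteness of
DomainSAW for bounded D.carrier and δ > 0 (meshDomain_finite) the laws are probability measures for
δ ∈ (0, δ₁]; since DomainSAW may be EMPTY at junk δ, run the criterion on the push-forward side (Ωδ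
:= CurveClass ℂ, Y := id, P δ := (law …).map curve for δ ≤ δ₁, a f -/
@[route_item "route-CriticalPhenomena-SAWEdgeOfPositiveType", crux]
def TightIdentificationCriterion : Prop :=
  ∀ (D : Literature.Probability.RandomPlanarGeometry.DobrushinDomain) (a b : ℝ → Literature.Probability.LatticeModels.Site 2), Literature.Probability.RandomPlanarGeometry.SAW.IsEndpointApprox D a b → ∀ δ₀ : ℝ, 0 < δ₀ → MeasureTheory.IsTightMeasureSet ((fun δ => (Literature.Probability.RandomPlanarGeometry.SAW.law D.carrier δ (a δ) (b δ)).map (fun γ => γ.curve)) '' Set.Ioc 0 δ₀) → (∀ (s : ℕ → ℝ) (μ : MeasureTheory.Measure (Literature.Probability.RandomPlanarGeometry.CurveClass ℂ)), Filter.Tendsto s Filter.atTop (nhdsWithin 0 (Set.Ioi 0)) → MeasureTheory.IsProbabilityMeasure μ → (∀ f : BoundedContinuousFunction (Literature.Probability.RandomPlanarGeometry.CurveClass ℂ) ℝ, Filter.Tendsto (fun n => ∫ γ, f γ.curve ∂(Literature.Probability.RandomPlanarGeometry.SAW.law D.carrier (s n) (a (s n)) (b (s n)))) Filter.atTop (nhds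 (∫ x, f x ∂μ))) → Literature.Probability.RandomPlanarGeometry.IsSLELaw ((8 : NNReal) / 3) D μ) → Literature.Probability.RandomPlanarGeometry.ConvergesInLawToSLE ((8 : NNReal) / 3) D (fun δ (γ : Literature.Probability.RandomPlanarGeometry.SAW.DomainSAW D.carrier δ (a δ) (b δ)) => γ.curve) (fun δ => Literature.Probability.RandomPlanarGeometry.SAW.law D.carrier δ (a δ) (b δ))

-- `TightIdentificationCriterion` holds: proved by `Summit.CriticalPhenomena.SAWScalingLimit.Theorems.edgeOfPositiveType_tightIdentificationCriterion_proof` @ 6c5f5409437e (its module imports this route file, so no `_holds` link can be stated here).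

/-- item stmt-CriticalPhenomena-1372 · support · rank 9 · open · by planner
sources: KemppainenSmirnov2017, AizenmanBurchardDuke1999, Summit.CriticalPhenomena.SAWScalingLimit.Theorems.SAWParafermionTight_refuted, DuminilCopinHammond2013
[support] eventual tightness of the pushed-forward critical SAW laws: for every Dobrushin domain and
endpoint approximation there is δ₀ > 0 such that {(law D δ a_δ b_δ).map curve : δ ∈ (0, δ₀]} is a
tight set of measures on CurveClass ℂ — the repaired (∃ δ₀) form of the refuted all-δ statement
stmt-CriticalPhenomena-0772 suggested by its refutation; child-designate of LimitExists, shared need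
of every SAW route. Intended tools: Aizenman–Burchard / Kemppainen–Smirnov Condition G2 (an
annulus-crossing bound at x_c not in print). Sources: KemppainenSmirnov2017 Thm 1.5,
AizenmanBurchardDuke1999, DuminilCopinHammond2013. -/
@[route_item "route-CriticalPhenomena-SAWEdgeOfPositiveType"]
def EventualTight : Prop :=
  ∀ (D : Literature.Probability.RandomPlanarGeometry.DobrushinDomain) (a b : ℝ → Literature.Probability.LatticeModels.Site 2), Literature.Probability.RandomPlanarGeometry.SAW.IsEndpointApprox D a b → ∃ δ₀ : ℝ, 0 < δ₀ ∧ MeasureTheory.IsTightMeasureSet ((fun δ => (Literature.Probability.RandomPlanarGeometry.SAW.law D.carrier δ (a δ) (b δ)).map (fun γ => γ.curve)) '' Set.Ioc 0 δ₀)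

/-- item stmt-CriticalPhenomena-13974 · support · rank 9 · closed · proved by Summit.CriticalPhenomena.SAWScalingLimit.Theorems.SchoenbergToMetric_proof (prover) · by planner
sources: BergChristensenRessel1984, Literature.Analysis.Matrix.sqrt_neg_log_triangle_of_rpow_posDef, Literature.Analysis.Matrix.Schoenberg1938_negDef_iff_exp_posDef_holds
[support] (provable now, M) ConvexInfiniteDivisibility → ConvexMetricTriangle: fix K, Λ, x and a
triple a, b, c with Z(a,b), Z(b,c) > 0; restrict to the component C of Λ's induced graph containing
them (for x > 0 every entry of Z on C × C is > 0 by concatenating confined walks and loop-erasing; x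
= 0 forces a = b = c); the principal submatrix on C of a positive definite matrix is positive
definite (zero-extend the test vector), so every Hadamard power of Z|_C is a positive definite
kernel in the sense of Literature.Analysis.Matrix.IsPosDefKernel (families with repeats are handled
by PosSemidef of the Gram-type pullback); apply
Literature.Analysis.Matrix.sqrt_neg_log_triangle_of_rpow_posDef with the PROVED facts
Schoenberg1938_negDef_iff_exp_posDef_holds and BCR1984_sqrt_negDef_semimetric_holds
(SchoenbergKernelsProofs.lean) — it returns Z ≤ 1 and the √(−log Z) triangle inequality on C. [deps:
ConvexInfiniteDivisibility, ConvexMetricTriangle] [difficulty: M] -/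
@[route_item "route-CriticalPhenomena-SAWEdgeOfPositiveType"]
def SchoenbergToMetric : Prop :=
  ConvexInfiniteDivisibility → ConvexMetricTriangle

-- `SchoenbergToMetric` holds: proved by `Summit.CriticalPhenomena.SAWScalingLimit.Theorems.SchoenbergToMetric_proof` (its module imports this route file, so no `_holds` link can be stated here).

/-- item stmt-CriticalPhenomena-4728 · support · rank 9 · open · by planner
sources: AizenmanBurchardDuke1999, KemppainenSmirnov2017, DuminilCopinHammond2013, Literature.Probability.RandomPlanarGeometry.isTightMeasureSet_of_traversalBounds
[crux] (card E3 output; Aizenman–Burchard (H1) for the SAW) for every Dobrushin domain D and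
endpoint approximation (a_δ,b_δ) there are a shell-dependent threshold k : ℂ → ℝ → ℝ → ℕ, constants
K, λ > 2 and δ₀ > 0 such that for all δ ∈ (0,δ₀], all x ∈ ℂ and δ ≤ ρ < R ≤ 1: P_δ[the SAW polyline
traverses the shell D(x; ρ, R) by k(x,ρ,R) separate segments] ≤ K (ρ/R)^λ (Curve.HasTraversals of
CurveTortuosity.lean). k may depend on the shell because ∂Ω (fjords, oscillating corridors near a)
can force any fixed finite number of traversals deterministically — exactly the freedom the in-tree
criterion isTightMeasureSet_of_traversalBounds allows. [deps: AnnularMassDecay, TubeLowerBound]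
[difficulty: open-problem] -/
@[route_item "route-CriticalPhenomena-SAWEdgeOfPositiveType"]
def ShellCrossingBound : Prop :=
  ∀ (D : Literature.Probability.RandomPlanarGeometry.DobrushinDomain) (a b : ℝ → Literature.Probability.LatticeModels.Site 2), Literature.Probability.RandomPlanarGeometry.SAW.IsEndpointApprox D a b → ∃ (k : ℂ → ℝ → ℝ → ℕ) (K lam δ₀ : ℝ), 2 < lam ∧ 0 < δ₀ ∧ ∀ δ ∈ Set.Ioc (0 : ℝ) δ₀, ∀ (x : ℂ) (ρ R : ℝ), δ ≤ ρ → ρ < R → R ≤ 1 → Literature.Probability.RandomPlanarGeometry.SAW.law D.carrier δ (a δ) (b δ) {γ | (⟨γ.walk.toCurve (Literature.Probability.LatticeModels.meshPoint δ)⟩ : Literature.Probability.RandomPlanarGeometry.Curve ℂ).HasTraversals (k x ρ R) x ρ R} ≤ ENNReal.ofReal (K * (ρ / R) ^ lam)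

/-- item stmt-CriticalPhenomena-4730 · support · rank 9 · open · by planner
sources: MadrasSlade1993, DuminilCopinHammond2013, arXiv:1305.1257, arXiv:1809.00760
[crux] (card E2, SAW-RSW lower bound) there are C and c > 0 such that for all vertices u, v of ℤ²
and ℓ ≥ 1 with |u − v| ≤ ℓ, the x_c-mass of self-avoiding walks from u to v all of whose vertices
stay within distance ℓ/10 + 2 of the segment [u, v] is ≥ c ℓ^{−C} (some partial sum already exceeds
the bound). Implies the card's obstacle form (K at distance ≥ ℓ/10 from [u,v] is not met) and is
what the surgery needs to re-glue a walk after excising an annular excursion. [deps: KestenIdentity]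
[difficulty: L] -/
@[route_item "route-CriticalPhenomena-SAWEdgeOfPositiveType"]
def TubeLowerBound : Prop :=
  ∃ C c : ℝ, 0 < c ∧ ∀ (u v : Literature.Probability.LatticeModels.Site 2) (ℓ : ℝ), 1 ≤ ℓ → dist (Literature.Probability.LatticeModels.Site.toComplex u) (Literature.Probability.LatticeModels.Site.toComplex v) ≤ ℓ → ∃ N : ℕ, c * ℓ ^ (-C) ≤ ∑ n ∈ Finset.range (N + 1), ∑ _ω ∈ (Literature.Probability.RandomPlanarGeometry.SAW.Zd.sawFun 2 n (v - u)).filter (fun ω => ∀ i ≤ n, Metric.infDist (Literature.Probability.LatticeModels.Site.toComplex (u + ω i)) (segment ℝ (Literature.Probability.LatticeModels.Site.toComplex u) (Literature.Probability.LatticeModels.Site.toComplex v)) ≤ ℓ / 10 + 2), Literature.Probability.RandomPlanarGeometry.SAW.criticalFugacity ^ n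

/-- item stmt-CriticalPhenomena-4731 · support · rank 9 · open · by planner
sources: Kesten1987, DuminilCopinHammond2013, arXiv:1305.1257, AizenmanBurchardDuke1999
[support] (card E3, the foreseen glue of the split r2 ⇐ r3, r4) AnnularMassDecay → TubeLowerBound →
ShellCrossingBound: a k-fold traversal of D(x;ρ,R) by the SAW in Ω_δ contains k disjoint annular
bridges alternating in direction; excise an in–out pair, re-glue through a tube connector
(TubeLowerBound pays ℓ^-C), and bound the multiplicity of the multi-valued map by the x_c-mass of
the excised double excursion (AnnularMassDecay pays (ρ/R)^θ per pair, uniformly in the slit domain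
by monotonicity in the domain); iterate: λ_k ≥ cθk − C′, choose k with λ_k > 2. Filed as support so
that anyone may attempt it; it becomes the glue item of `route edit --split ShellCrossingBound
--into AnnularMassDecay TubeLowerBound` once r3 or r4 has traction. [difficulty: XL] -/
@[route_item "route-CriticalPhenomena-SAWEdgeOfPositiveType", crux]
def SurgeryReduction : Prop :=
  AnnularMassDecay → TubeLowerBound → ShellCrossingBound

/-- item stmt-CriticalPhenomena-4732 · support · rank 9 · closed · proved by Summit.CriticalPhenomena.SAWScalingLimit.Theorems.TightOfShellCrossing_proof (prover) · by planner
sources: AizenmanBurchardDuke1999, Literature.Probability.RandomPlanarGeometry.isTightMeasureSet_of_traversalBounds, Literature.Probability.RandomPlanarGeometry.exists_finset_card_le_cover_closedBall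
[support] ShellCrossingBound → EventualTight, by the PROVED Aizenman–Burchard criterion
isTightMeasureSet_of_traversalBounds with Λ = closure of a bounded neighbourhood of Ω (compact), d =
2 covering numbers (exists_finset_card_le_cover_closedBall), T = (0, δ₀], X_δ = the SAW polyline;
hypothesis (H0) (no k traversals of shells of inner radius ≤ δ) holds for self-avoiding polylines of
step δ once k exceeds an absolute constant (a SAW uses each of the ≤ 12 edges within δ of x at most
once), so replace k by max k k₀ using HasTraversals.of_le. [difficulty: provable-now] -/
@[route_item "route-CriticalPhenomena-SAWEdgeOfPositiveType", crux]
def TightOfShellCrossing : Prop :=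
  ShellCrossingBound → EventualTight

/-- `TightOfShellCrossing` holds: proved by `Summit.CriticalPhenomena.SAWScalingLimit.Theorems.TightOfShellCrossing_proof`. -/
theorem TightOfShellCrossing_holds : TightOfShellCrossing := _root_.Summit.CriticalPhenomena.SAWScalingLimit.Theorems.TightOfShellCrossing_proof

/-- item stmt-CriticalPhenomena-13964 · support · rank 10 · closed · proved by Summit.CriticalPhenomena.SAWScalingLimit.Theorems.ConvexMetricUpgrade_proof (prover) · by planner
sources: BergChristensenRessel1984, MadrasSlade1993, route-CriticalPhenomena-SAWRenewalTightness item stmt-CriticalPhenomena-4730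
[support] (rev 2 engine, replaces MetricUpgrade stmt-8264 whose antecedent was the all-Λ
MetricTriangle; provable now, M; rank 10 only so that the gate renders it after the shared supports
it names) ConvexMetricTriangle → AveragedTubeMass → TubeLowerBound — the route's engine: with T :=
the lattice sites within ℓ/10 + 2 of the segment [u,v] (finite; the trace of K = Metric.cthickening
(ℓ/10+2) (segment ℝ u v), convex by Convex.cthickening, so (CMT) applies in T), g(s) := sup over
tube pairs at scale ≤ s of F^T, pigeonhole on the averaged mass gives v* ∈ B(v, ℓ^α) with F^T(u,v*)
≤ (C + 2α) log ℓ + O(1); the tube of (v*, v, max(1,|v*−v|)) lies inside T once 1.1 ℓ^α ≤ ℓ/10, so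
F^T(v*,v) ≤ g(ℓ^α) by monotonicity of confined SAW sums in the domain; (CMT) at x = x_c in T (its
hypotheses Z^T(u,v*) > 0, Z^T(v*,v) > 0 hold by pigeonhole and a staircase) gives √g(ℓ) ≤ √(C₁ log
ℓ) + √g(ℓ^α), iterated along ℓ, ℓ^α, ℓ^(α²), … down to a fixed scale (staircase: F ≤ 2ℓ₀ log μ):
g(ℓ) ≤ C₁ log ℓ/(1 − √α)² + O(√log ℓ), i.e. TubeLowerBound with exponent C₁/(1−√α)² + 1; split the
case α ≤ 0 (then AveragedTubeMass is already pointwise); if Z^T(u,v) ≥ 1 the bound is trivial, so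
the junk value of √ on neg -/
@[route_item "route-CriticalPhenomena-SAWEdgeOfPositiveType", crux]
def ConvexMetricUpgrade : Prop :=
  ConvexMetricTriangle → AveragedTubeMass → TubeLowerBound

-- `ConvexMetricUpgrade` holds: proved by `Summit.CriticalPhenomena.SAWScalingLimit.Theorems.ConvexMetricUpgrade_proof` (its module imports this route file, so no `_holds` link can be stated here).

-- earlier Assembly (stmt-CriticalPhenomena-11296, replaced 2026-08-15T23:32:52Z -> stmt-CriticalPhenomena-13971): retired by None — MetricTriangle → AveragedTubeMass → MetricUpgrade → AnnularMassDecay → SurgeryReduction → TightOfShellCrossing → SubseqIdentification → TightIdentificationCriterion → SAWScalingLimit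
-- earlier Assembly (stmt-CriticalPhenomena-8265, replaced 2026-08-15T16:57:29Z -> stmt-CriticalPhenomena-11296): retired by None — MetricTriangle → AveragedTubeMass → MetricUpgrade → AnnularMassDecay → SurgeryReduction → TightOfShellCrossing → SubseqIdentification → SAWScalingLimit
/-- item stmt-CriticalPhenomena-13971 · assembly · rank 1 · closed · proved by Summit.CriticalPhenomena.SAWScalingLimit.Theorems.edgeOfPositiveType_assembly_proof (prover) · by planner
sources: Literature.Probability.RandomPlanarGeometry.convergesInLawToSLE_of_isTightAlongMesh, Literature.Probability.RandomPlanarGeometry.IsSLECurve.map_eq_holds, Literature.Probability.RandomPlanarGeometry.SAW.aemeasurable_curve, route-CriticalPhenomena-SAWRenewalTightness item stmt-CriticalPhenomena-4538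
[assembly] (rev 2: restated to the exact type of the deciding theorem `closes`) ConvexMetricTriangle
→ AveragedTubeMass → ConvexMetricUpgrade → AnnularMassDecay → SurgeryReduction →
TightOfShellCrossing → SubseqIdentification → TightIdentificationCriterion → SAWScalingLimit — pure
composition: ConvexMetricUpgrade CMT Avg : TubeLowerBound; SurgeryReduction AMD _ :
ShellCrossingBound; TightOfShellCrossing _ : EventualTight; at each (D, a, b) with IsEndpointApprox
feed EventualTight's δ₀-tightness and SubseqIdentification into TightIdentificationCriterion and
unfold SAWScalingLimit. Provable now: `theorem Assembly_holds : Assembly := closes` (planner's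
Sketch.lean, lean rc 0). [difficulty: provable-now] -/
@[route_item "route-CriticalPhenomena-SAWEdgeOfPositiveType"]
def Assembly : Prop :=
  ConvexMetricTriangle → AveragedTubeMass → ConvexMetricUpgrade → AnnularMassDecay → SurgeryReduction → TightOfShellCrossing → SubseqIdentification → TightIdentificationCriterion → SAWScalingLimit

-- `Assembly` holds: proved by `Summit.CriticalPhenomena.SAWScalingLimit.Theorems.edgeOfPositiveType_assembly_proof` (its module imports this route file, so no `_holds` link can be stated here).

-- records of items no longer active in this route (dropped / restated):
-- earlier InfiniteDivisibility (stmt-CriticalPhenomena-8261, dropped 2026-08-15T16:57:29Z): refuted by Summit.CriticalPhenomena.SAWScalingLimit.Theorems.SAWEdgeOfPositiveTypeInfiniteDivisibility_refuted — ∀ (Λ : Finset (Literature.Probability.LatticeModels.Site 2)) (x t : ℝ), 0 ≤ x → x ≤ Literature.Probability.RandomPlanarGeometry.SAW.criticalFugacity → 0 < t → let Z : Literature.Probability.Lattice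

/-! D-0027 §2.1 — DECIDING THEOREM (planner-authored via `route open/edit --closes-file`; by planner-rchoice-CriticalPhenomena-SAWEdgeOfPos-04104920-0 2026-08-15T23:32:52Z):
its hypotheses are this route's items and its conclusion the sub-problem Statement (glue_lint), and it elaborates with this file. -/

@[closes "route-CriticalPhenomena-SAWEdgeOfPositiveType"] theorem closes (h_ConvexMetricTriangle : ConvexMetricTriangle) (h_AveragedTubeMass : AveragedTubeMass)
    (h_ConvexMetricUpgrade : ConvexMetricUpgrade) (h_AnnularMassDecay : AnnularMassDecay)
    (h_SurgeryReduction : SurgeryReduction) (h_TightOfShellCrossing : TightOfShellCrossing)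
    (h_SubseqIdentification : SubseqIdentification)
    (h_TightIdentificationCriterion : TightIdentificationCriterion) : _root_.SAWScalingLimit :=
  fun D a b hab =>
    (h_TightOfShellCrossing (h_SurgeryReduction h_AnnularMassDecay
      (h_ConvexMetricUpgrade h_ConvexMetricTriangle h_AveragedTubeMass)) D a b hab).elim
      fun δ₀ h => h_TightIdentificationCriterion D a b hab δ₀ h.1 h.2 (h_SubseqIdentification D a b hab)

end Summit.CriticalPhenomena.SAWScalingLimit.Theses.SAWEdgeOfPositiveType
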